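import Literature.NumberTheory.Sieve.HeathBrownCubicTypeIIS4Bound
import Literature.NumberTheory.Sieve.HeathBrownCubicTypeIIBudget
import HarnessLib

/-!
# Heath-Brown's Lemma 3.10, §13 p. 83: the bound for `S = S₁ + S₂`

Support for the proof of **Lemma 3.10** of D. R. Heath-Brown, *Primes represented by `x³ + 2y³`*,
Acta Math. 186 (2001), Lemma 12.2 and §13 p. 83:

> "We now choose `Q₀ = Q₁^{1/2}`, so that `S₈ ≪ XV(YQ₁² exp{−c√(log L)} + YQ₁^{−1/4} + Y⁴⁶X^{−τ/2})(log X)^c`,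
> whence Lemma 12.2 yields `S_V ≪ X²(Y^{−1/2} + Y³⁰X^{−τ/4} + Y⁸Q₁^{−1/8} + Y⁸Q₁² exp{−c√(log L)})(log X)^c`."

We PROVE the corresponding bound for `S = S₁ + S₂` (`Ssum` of `HeathBrownCubicTypeIICauchy`) under an
explicit list of parameter inequalities (discharged eventually in `X` in the final file):
`S ≤ K · XV · (Y⁻¹ + Y⁶⁰X^{−τ/2} + Y¹⁶Q₁^{−1/4} + Y¹⁶Q₁⁴e^{−c₁√(log L)}) (log X)^{c₀}` (`Ssum_le_of_params`),
with `T = V^{1/3}`, `N = 1248(⌊Y⌋₊ + 1)²`, `Δ₀ = V/(XY)`, `d₀ = VY⁷/X`, `Q₀ = ⌊Q₁^{1/3}⌋₊`, combining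
`abs_S4plus_le`, `abs_S3sum_le`, the `S₁` bound and the tail bound with the budget inequalities.

## References

* D. R. Heath-Brown, *Primes represented by `x³ + 2y³`*, Acta Math. 186 (2001), Lemma 12.2, §13 p. 83.
  [cite: HeathBrownActa2001, §13 p. 83]

## Mathlib / tree search

Tree: `HeathBrownCubicTypeIIS4Bound` (`abs_S4plus_le`), `HeathBrownCubicTypeIIOffDiag` (`abs_S3sum_le`,
`S2sum_eq_S3_add_S4`), `HeathBrownCubicTypeIIForms` (`S4sum_eq_two_mul_S4plus`), `HeathBrownCubicTypeIICauchy`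
(`Ssum_eq_S1_add_S2`, `Fb_sq_le`), `HeathBrownCubicTypeIIBudget`.
-/

noncomputable section

open Finset NumberField

namespace Literature.NumberTheory.Sieve.CubicSieve

open LFunctions.CubeRootTwoField CubicPrimes LargeSieve

/-! ### Elementary facts on the parameters -/

/-- `x/2 ≤ ⌊x⌋₊` for `x ≥ 1`. [folklore] -/
theorem half_le_floor {x : ℝ} (hx : 1 ≤ x) : x / 2 ≤ (⌊x⌋₊ : ℝ) := by
  have h1 := Nat.lt_floor_add_one x
  have h2 : (1 : ℝ) ≤ ⌊x⌋₊ := by exact_mod_cast Nat.le_floor (by simpa using hx)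
  linarith

/-- The hypercube parameter `N = 1248(⌊Y⌋₊ + 1)²`: `1248 ≤ N`, `Y² ≤ N ≤ 4992Y²` (`Y ≥ 1`). [folklore] -/
theorem N_param_facts {Y : ℝ} (hY : 1 ≤ Y) :
    1248 ≤ 1248 * (⌊Y⌋₊ + 1) ^ 2 ∧ Y ^ 2 ≤ ((1248 * (⌊Y⌋₊ + 1) ^ 2 : ℕ) : ℝ) ∧
      ((1248 * (⌊Y⌋₊ + 1) ^ 2 : ℕ) : ℝ) ≤ 4992 * Y ^ 2 := by
  have h1 := Nat.lt_floor_add_one Y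
  have h2 : (⌊Y⌋₊ : ℝ) ≤ Y := Nat.floor_le (by linarith)
  refine ⟨Nat.le_mul_of_pos_right _ (by positivity), ?_, ?_⟩
  · push_cast
    nlinarith
  · push_cast
    nlinarith

/-! ### The pieces of `2|S₄⁺|` -/

/-- Logarithm bookkeeping: `log(270·Y) ≤ 10 log X`, `1 + log(2d₀) ≤ 11 log X`, `1 + log Q₀ ≤ 3 log X`,
`1 + log(⌊3T⌋₊ + 1) ≤ 5 log X`, `log(6T + 2) ≤ 4 log X` (`X ≥ 2`, `1 ≤ log X`, `Y, T, Q₀ ≤ X`, `d₀ ≤ X⁹`).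
[folklore] -/
theorem log_bookkeeping {X Y T Q₀ d₀ : ℝ} (hX : 2 ≤ X) (hlogX : 1 ≤ Real.log X) (hY1 : 1 ≤ Y) (hYX : Y ≤ X)
    (hT1 : 1 ≤ T) (hTX : T ≤ X) (hQ₀1 : 1 ≤ Q₀) (hQ₀X : Q₀ ≤ X) (hd1 : 1 ≤ d₀) (hdX : d₀ ≤ X ^ 9) :
    Real.log (270 * Y) ≤ 10 * Real.log X ∧ 1 + Real.log (2 * d₀) ≤ 11 * Real.log X ∧
      1 + Real.log Q₀ ≤ 3 * Real.log X ∧ 1 + Real.log ((⌊3 * T⌋₊ + 1 : ℕ) : ℝ) ≤ 5 * Real.log X ∧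
      Real.log (2 * (3 * T) + 2) ≤ 4 * Real.log X := by
  have hX0 : 0 < X := by linarith
  have hl2 : Real.log 2 ≤ Real.log X := Real.log_le_log (by norm_num) hX
  have hl2' : (0.6931471803 : ℝ) ≤ Real.log 2 := Real.log_two_gt_d9.le
  have hlogY : Real.log Y ≤ Real.log X := Real.log_le_log (by linarith) hYX
  have hlogT : Real.log T ≤ Real.log X := Real.log_le_log (by linarith) hTX
  have hlogQ : Real.log Q₀ ≤ Real.log X := Real.log_le_log (by linarith) hQ₀X
  refine ⟨?_, ?_, ?_, ?_, ?_⟩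
  · rw [Real.log_mul (by norm_num) (by linarith)]
    have : Real.log 270 ≤ 9 * Real.log 2 := by
      rw [← Real.log_rpow (by norm_num)]
      exact Real.log_le_log (by norm_num) (by norm_num)
    nlinarith
  · rw [Real.log_mul (by norm_num) (by linarith)]
    have : Real.log d₀ ≤ 9 * Real.log X := by
      have h := Real.log_le_log (by linarith) hdX
      rw [Real.log_pow] at h; push_cast at h; linarith
    nlinarith
  · nlinarith
  · have h1 : ((⌊3 * T⌋₊ + 1 : ℕ) : ℝ) ≤ 4 * X := by
      push_cast; linarith [Nat.floor_le (show (0:ℝ) ≤ 3 * T by linarith)]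
    have h2 : Real.log ((⌊3 * T⌋₊ + 1 : ℕ) : ℝ) ≤ Real.log (4 * X) :=
      Real.log_le_log (by positivity) h1
    rw [Real.log_mul (by norm_num) hX0.ne'] at h2
    have : Real.log 4 = 2 * Real.log 2 := by
      rw [show (4:ℝ) = 2 ^ 2 by norm_num, Real.log_pow]; ring
    nlinarith
  · have h1 : 2 * (3 * T) + 2 ≤ 8 * X := by linarith
    have h2 : Real.log (2 * (3 * T) + 2) ≤ Real.log (8 * X) := Real.log_le_log (by linarith) h1
    rw [Real.log_mul (by norm_num) hX0.ne'] at h2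
    have : Real.log 8 = 3 * Real.log 2 := by
      rw [show (8:ℝ) = 2 ^ 3 by norm_num, Real.log_pow]; ring
    nlinarith

/-- A piece `c·B·u·L₁ ≤ c·(B·U·L₂)` once `u ≤ U`, `L₁ ≤ L₂`. [folklore] -/
theorem piece_le {c B u U L₁ L₂ : ℝ} (hc : 0 ≤ c) (hB : 0 ≤ B) (hu : 0 ≤ u) (huU : u ≤ U) (hL : 0 ≤ L₁)
    (hL12 : L₁ ≤ L₂) : c * B * u * L₁ ≤ c * (B * U * L₂) := by
  have hU : 0 ≤ U := hu.trans huU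
  have h1 : c * B * u * L₁ ≤ c * B * U * L₂ :=
    mul_le_mul (mul_le_mul_of_nonneg_left huU (mul_nonneg hc hB)) hL12 hL (by positivity)
  linarith

/-- **The Class II piece**: `2·(N log(270Y) + 2)(3.4·10¹⁰(6N+3)⁵)(81 C₁₁ s⁶(log s)^E(2/(NΔ₀) + 3/Δ₀²))
≤ 2·81·3.4·10¹⁰·12·9⁵·(2 + 3/c₅)·C₁₁ · XT³Y⁻¹ · (log X)^{E+1}`. [cite: HeathBrownActa2001, §13 p. 83] -/
theorem piece_classII {X Y T N Δ₀ c₅ C₁₁ : ℝ} {E : ℕ} (hX : 2 ≤ X) (hlogX : 1 ≤ Real.log X) (hY : 1 ≤ Y)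
    (hYX : Y ≤ X) (hT : 0 < T) (hN1 : 1 ≤ N) (hNY : Y ^ 2 ≤ N) (hΔ : Δ₀ = T ^ 3 / (X * Y)) (hc₅ : 0 < c₅)
    (hc₅V : c₅ * X * Y ^ 3 ≤ T ^ 3) (hC₁₁ : 0 ≤ C₁₁) (hls0 : 0 ≤ Real.log (T / N)) (hls : Real.log (T / N) ≤ Real.log X) :
    2 * ((N * (Real.log (270 * (T ^ 3) / X) - Real.log Δ₀) + 2) * (34000000000 * (6 * N + 3) ^ 5) *
        (81 * (C₁₁ * (T / N) ^ 6 * Real.log (T / N) ^ E * (2 / (N * Δ₀) + 3 / Δ₀ ^ 2)))) ≤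
      2 * 81 * 34000000000 * 12 * 9 ^ 5 * (2 + 3 / c₅) * C₁₁ * (X * T ^ 3 * Y⁻¹) * Real.log X ^ (E + 1) := by
  have hX0 : 0 < X := by linarith
  have hY0 : 0 < Y := by linarith
  have hN0 : 0 < N := by linarith
  -- the logarithm: `log(270 V/X) - log Δ₀ = log(270 Y) ≤ 10 log X`
  have hlog1 : Real.log (270 * (T ^ 3) / X) - Real.log Δ₀ = Real.log (270 * Y) := by
    rw [hΔ, ← Real.log_div (by positivity) (by positivity)]
    congr 1; field_simp
  have hlog270 : Real.log (270 * Y) ≤ 10 * Real.log X := by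
    rw [Real.log_mul (by norm_num) hY0.ne']
    have hl2 : Real.log 2 ≤ Real.log X := Real.log_le_log (by norm_num) hX
    have : Real.log 270 ≤ 9 * Real.log 2 := by
      rw [← Real.log_rpow (by norm_num)]; exact Real.log_le_log (by norm_num) (by norm_num)
    have hlogY : Real.log Y ≤ Real.log X := Real.log_le_log hY0 hYX
    nlinarith
  have hA : N * (Real.log (270 * (T ^ 3) / X) - Real.log Δ₀) + 2 ≤ 12 * N * Real.log X := by
    rw [hlog1]
    have : N * Real.log (270 * Y) ≤ N * (10 * Real.log X) := mul_le_mul_of_nonneg_left hlog270 hN0.le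
    nlinarith
  have hA0 : 0 ≤ N * (Real.log (270 * (T ^ 3) / X) - Real.log Δ₀) + 2 := by
    rw [hlog1]; have : 0 ≤ Real.log (270 * Y) := Real.log_nonneg (by linarith)
    positivity
  have hB : (6 * N + 3) ^ 5 ≤ (9 * N) ^ 5 := pow_le_pow_left₀ (by positivity) (by linarith) 5
  have hlogE : Real.log (T / N) ^ E ≤ Real.log X ^ E := pow_le_pow_left₀ hls0 hls E
  -- `(T/N)⁶ (2/(NΔ₀) + 3/Δ₀²) = (2XYT³/N + 3X²Y²)/N⁶`
  have hgeom : (T / N) ^ 6 * (2 / (N * Δ₀) + 3 / Δ₀ ^ 2) = (2 * X * Y * T ^ 3 / N + 3 * X ^ 2 * Y ^ 2) / N ^ 6 := by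
    rw [hΔ]; field_simp
  have hbud := budget_classII hX0 hY hT hc₅ hNY hc₅V
  have hgeom_le : (T / N) ^ 6 * (2 / (N * Δ₀) + 3 / Δ₀ ^ 2) ≤ (2 + 3 / c₅) * (X * T ^ 3 / Y) / N ^ 6 := by
    rw [hgeom]; exact div_le_div_of_nonneg_right hbud (by positivity)
  have hgeom0 : 0 ≤ (T / N) ^ 6 * (2 / (N * Δ₀) + 3 / Δ₀ ^ 2) := by rw [hgeom]; positivity
  calc 2 * ((N * (Real.log (270 * (T ^ 3) / X) - Real.log Δ₀) + 2) * (34000000000 * (6 * N + 3) ^ 5) *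
        (81 * (C₁₁ * (T / N) ^ 6 * Real.log (T / N) ^ E * (2 / (N * Δ₀) + 3 / Δ₀ ^ 2))))
      = 2 * 34000000000 * 81 * C₁₁ * ((N * (Real.log (270 * (T ^ 3) / X) - Real.log Δ₀) + 2) * (6 * N + 3) ^ 5 *
          (Real.log (T / N) ^ E * ((T / N) ^ 6 * (2 / (N * Δ₀) + 3 / Δ₀ ^ 2)))) := by ring
    _ ≤ 2 * 34000000000 * 81 * C₁₁ * ((12 * N * Real.log X) * (9 * N) ^ 5 *
          (Real.log X ^ E * ((2 + 3 / c₅) * (X * T ^ 3 / Y) / N ^ 6))) := by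
        gcongr
    _ = 2 * 81 * 34000000000 * 12 * 9 ^ 5 * (2 + 3 / c₅) * C₁₁ * (X * T ^ 3 * Y⁻¹) * Real.log X ^ (E + 1) := by
        field_simp; ring

/-- **The large-sieve piece**: `2(6N+3)⁶ · 414720(1 + log 2d₀)/Δ₀ ((s+1)³/Q₀ + d₀(s+1)² + d₀³)(81C₂s³(log s)^{e₂})
≤ 2·9⁶·414720·11·81·C₂ · XT³ · (16 Y¹⁶Q₁^{−1/4} + (19968 + 4992³) Y⁶⁰/W) (log X)^{e₂+1}`.
[cite: HeathBrownActa2001, §13 p. 83] -/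
theorem piece_large {X Y T N Δ₀ d₀ Q₁ W C₂ : ℝ} {Q₀ : ℕ} {e₂ : ℕ} (hX : 2 ≤ X) (hlogX : 1 ≤ Real.log X) (hY : 1 ≤ Y)
    (hT : 0 < T) (hN1 : 1 ≤ N) (hNY : N ≤ 4992 * Y ^ 2) (hs1 : 1 ≤ T / N) (hΔ : Δ₀ = T ^ 3 / (X * Y))
    (hd : d₀ = T ^ 3 * Y ^ 7 / X) (hd1 : 1 ≤ d₀) (hlogd : 1 + Real.log (2 * d₀) ≤ 11 * Real.log X) (hQ₁ : 1 ≤ Q₁)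
    (hQ₀ : Q₁ ^ (1 / 3 : ℝ) / 2 ≤ (Q₀ : ℝ)) (hW : 1 ≤ W) (hTW : T ^ 2 * W ≤ X) (hC₂ : 0 ≤ C₂)
    (hls0 : 0 ≤ Real.log (T / N)) (hls : Real.log (T / N) ≤ Real.log X) :
    2 * (6 * N + 3) ^ 6 * (414720 * (1 + Real.log (2 * d₀)) / Δ₀ *
        ((T / N + 1) ^ 3 / Q₀ + d₀ * (T / N + 1) ^ 2 + d₀ ^ 3) * (81 * (C₂ * (T / N) ^ 3 * Real.log (T / N) ^ e₂))) ≤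
      2 * 9 ^ 6 * 414720 * 11 * 81 * C₂ * (X * T ^ 3) *
        (16 * (Y ^ 16 * Q₁ ^ (-(1 / 4 : ℝ))) + (19968 + 4992 ^ 3) * (Y ^ 60 / W)) * Real.log X ^ (e₂ + 1) := by
  have hX0 : 0 < X := by linarith
  have hY0 : 0 < Y := by linarith
  have hN0 : 0 < N := by linarith
  have hs0 : 0 < T / N := by linarith
  have hΔ0 : 0 < Δ₀ := by rw [hΔ]; positivity
  have hd0 : 0 < d₀ := by linarith
  have hQ13 : 1 ≤ Q₁ ^ (1 / 3 : ℝ) := Real.one_le_rpow hQ₁ (by norm_num)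
  have hQ₀0 : (0 : ℝ) < Q₀ := lt_of_lt_of_le (by positivity) hQ₀
  have hlogd0 : 0 ≤ 1 + Real.log (2 * d₀) := by
    have : 0 ≤ Real.log (2 * d₀) := Real.log_nonneg (by linarith)
    linarith
  -- elementary monotonicity facts
  have hA : (6 * N + 3) ^ 6 ≤ (9 * N) ^ 6 := pow_le_pow_left₀ (by positivity) (by linarith) 6
  have hcube : (T / N + 1) ^ 3 ≤ 8 * (T / N) ^ 3 := by nlinarith [pow_le_pow_left₀ (by positivity) (show T / N + 1 ≤ 2 * (T / N) by linarith) 3]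
  have hsq : (T / N + 1) ^ 2 ≤ 4 * (T / N) ^ 2 := by nlinarith
  have hB : (T / N + 1) ^ 3 / Q₀ + d₀ * (T / N + 1) ^ 2 + d₀ ^ 3 ≤ 8 * (T / N) ^ 3 / Q₀ + 4 * d₀ * (T / N) ^ 2 + d₀ ^ 3 := by
    have h1 : (T / N + 1) ^ 3 / Q₀ ≤ 8 * (T / N) ^ 3 / Q₀ := div_le_div_of_nonneg_right hcube hQ₀0.le
    have h2 : d₀ * (T / N + 1) ^ 2 ≤ 4 * d₀ * (T / N) ^ 2 := by nlinarith
    linarith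
  have hB0 : 0 ≤ (T / N + 1) ^ 3 / Q₀ + d₀ * (T / N + 1) ^ 2 + d₀ ^ 3 := by positivity
  have hlogE : Real.log (T / N) ^ e₂ ≤ Real.log X ^ e₂ := pow_le_pow_left₀ hls0 hls e₂
  -- the geometric identity
  have hgeom : N ^ 6 * (Δ₀⁻¹ * ((8 * (T / N) ^ 3 / Q₀ + 4 * d₀ * (T / N) ^ 2 + d₀ ^ 3) * (T / N) ^ 3)) =
      X * Y * T ^ 3 * (8 / Q₀ + 4 * (T ^ 3 * Y ^ 7 / X) / (T / N) + (T ^ 3 * Y ^ 7 / X) ^ 3 / (T / N) ^ 3) := by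
    rw [hΔ, hd]; field_simp
  have hbud := budget_large hX0 hY hT hN0 hNY hQ₁ hQ₀ hW hTW
  have hK0 : 0 ≤ 2 * 414720 * 81 * 9 ^ 6 * 11 * C₂ * Real.log X ^ (e₂ + 1) := by positivity
  calc 2 * (6 * N + 3) ^ 6 * (414720 * (1 + Real.log (2 * d₀)) / Δ₀ *
        ((T / N + 1) ^ 3 / Q₀ + d₀ * (T / N + 1) ^ 2 + d₀ ^ 3) * (81 * (C₂ * (T / N) ^ 3 * Real.log (T / N) ^ e₂)))
      = 2 * 414720 * 81 * C₂ * ((6 * N + 3) ^ 6 * (1 + Real.log (2 * d₀)) * Real.log (T / N) ^ e₂ *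
          (Δ₀⁻¹ * (((T / N + 1) ^ 3 / Q₀ + d₀ * (T / N + 1) ^ 2 + d₀ ^ 3) * (T / N) ^ 3))) := by
        field_simp
    _ ≤ 2 * 414720 * 81 * C₂ * ((9 * N) ^ 6 * (11 * Real.log X) * Real.log X ^ e₂ *
          (Δ₀⁻¹ * ((8 * (T / N) ^ 3 / Q₀ + 4 * d₀ * (T / N) ^ 2 + d₀ ^ 3) * (T / N) ^ 3))) := by
        gcongr
    _ = 2 * 414720 * 81 * 9 ^ 6 * 11 * C₂ * Real.log X ^ (e₂ + 1) *
          (N ^ 6 * (Δ₀⁻¹ * ((8 * (T / N) ^ 3 / Q₀ + 4 * d₀ * (T / N) ^ 2 + d₀ ^ 3) * (T / N) ^ 3))) := by ring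
    _ = 2 * 414720 * 81 * 9 ^ 6 * 11 * C₂ * Real.log X ^ (e₂ + 1) *
          (X * Y * T ^ 3 * (8 / Q₀ + 4 * (T ^ 3 * Y ^ 7 / X) / (T / N) + (T ^ 3 * Y ^ 7 / X) ^ 3 / (T / N) ^ 3)) := by
        rw [hgeom]
    _ ≤ 2 * 414720 * 81 * 9 ^ 6 * 11 * C₂ * Real.log X ^ (e₂ + 1) *
          (16 * (X * T ^ 3 * Y ^ 16 * Q₁ ^ (-(1 / 4 : ℝ))) + (19968 + 4992 ^ 3) * (X * T ^ 3 / W * Y ^ 60)) :=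
        mul_le_mul_of_nonneg_left hbud hK0
    _ = _ := by field_simp

set_option maxHeartbeats 1000000 in
/-- **The small-moduli piece**: with `R = 2s²/(Q₁/Q₀) + 2s(1 + log(⌊3T⌋₊+1)) + (⌊3T⌋₊+1)` and
`H = C₁Ve^{−u}` (`u = c₁√(log L)`),
`2(6N+3)⁶ · 4(1 + log Q₀)/Δ₀ · Q₀³ · 2(Q₀⁴Q₁²H² + 162 (C₃s³(log s)^{e₃})^{2/3} R²)
≤ 48·9⁶ · XT³ · (4992⁶ C₁² Y¹⁶Q₁⁴e^{−u} log X + 486 C₃^{2/3} (12 Y¹⁶Q₁^{−1/4} + (100·4992² + 16·4992⁴) Y⁻¹)(log X)^{e₃+3})`.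
[cite: HeathBrownActa2001, §13 p. 83] -/
theorem piece_small {X Y T N Δ₀ Q₁ C₁ C₃ u : ℝ} {Q₀ : ℕ} {e₃ : ℕ} (hX : 2 ≤ X) (hlogX : 1 ≤ Real.log X)
    (hY : 1 ≤ Y) (hT1 : 1 ≤ T) (hN1 : 1 ≤ N) (hNY : N ≤ 4992 * Y ^ 2) (hs1 : 1 ≤ T / N) (hΔ : Δ₀ = T ^ 3 / (X * Y))
    (hQ₁ : 1 ≤ Q₁) (hQ₀1 : (1 : ℝ) ≤ Q₀) (hQ₀ : (Q₀ : ℝ) ≤ Q₁ ^ (1 / 3 : ℝ))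
    (hlogQ : 1 + Real.log (Q₀ : ℝ) ≤ 3 * Real.log X) (hlog3T : 1 + Real.log ((⌊3 * T⌋₊ + 1 : ℕ) : ℝ) ≤ 5 * Real.log X)
    (hYQ : Y ^ 10 * Q₁ ≤ T ^ 2) (hQe : Q₁ ^ (1 / 3 : ℝ) * Real.exp (-u) ≤ 1) (hC₃ : 0 ≤ C₃)
    (hls0 : 0 ≤ Real.log (T / N)) (hls : Real.log (T / N) ≤ Real.log X) :
    2 * (6 * N + 3) ^ 6 * (4 * (1 + Real.log (Q₀ : ℝ)) / Δ₀ * (Q₀ : ℝ) ^ 3 *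
        (2 * ((Q₀ : ℝ) ^ 4 * Q₁ ^ 2 * (C₁ * T ^ 3 * Real.exp (-u)) ^ 2 +
          162 * (C₃ * (T / N) ^ 3 * Real.log (T / N) ^ e₃) ^ (2 / 3 : ℝ) *
            (2 * (T / N) ^ 2 / (Q₁ / Q₀) + 2 * (T / N) * (1 + Real.log ((⌊3 * T⌋₊ + 1 : ℕ) : ℝ)) +
              ((⌊3 * T⌋₊ + 1 : ℕ) : ℝ)) ^ 2))) ≤
      48 * 9 ^ 6 * (X * T ^ 3) *
        (4992 ^ 6 * C₁ ^ 2 * (Y ^ 16 * Q₁ ^ 4 * Real.exp (-u)) * Real.log X +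
          486 * C₃ ^ (2 / 3 : ℝ) * (12 * (Y ^ 16 * Q₁ ^ (-(1 / 4 : ℝ))) + (100 * 4992 ^ 2 + 16 * 4992 ^ 4) * Y⁻¹) *
            Real.log X ^ (e₃ + 3)) := by
  have hX0 : 0 < X := by linarith
  have hY0 : 0 < Y := by linarith
  have hT : 0 < T := by linarith
  have hN0 : 0 < N := by linarith
  have hs0 : 0 < T / N := by linarith
  have hΔ0 : 0 < Δ₀ := by rw [hΔ]; positivity
  have hQ₁0 : 0 < Q₁ := by linarith
  have hQ₀0 : (0 : ℝ) < Q₀ := by linarith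
  have hQ₀Q : (Q₀ : ℝ) ≤ Q₁ := hQ₀.trans (by
    calc Q₁ ^ (1 / 3 : ℝ) ≤ Q₁ ^ (1 : ℝ) := Real.rpow_le_rpow_of_exponent_le hQ₁ (by norm_num)
      _ = Q₁ := Real.rpow_one Q₁)
  have hlogQ0 : 0 ≤ 1 + Real.log (Q₀ : ℝ) := by have := Real.log_nonneg hQ₀1; linarith
  have hlog3T0 : 0 ≤ 1 + Real.log ((⌊3 * T⌋₊ + 1 : ℕ) : ℝ) := by
    have : 0 ≤ Real.log ((⌊3 * T⌋₊ + 1 : ℕ) : ℝ) := Real.log_nonneg (by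
      have h0 : (0:ℝ) ≤ ⌊3 * T⌋₊ := Nat.cast_nonneg _
      push_cast; linarith)
    linarith
  have hfloor : ((⌊3 * T⌋₊ + 1 : ℕ) : ℝ) ≤ 4 * T := by
    push_cast; linarith [Nat.floor_le (show (0:ℝ) ≤ 3 * T by linarith)]
  set C₃r : ℝ := C₃ ^ (2 / 3 : ℝ) with hC₃r
  have hC₃r0 : 0 ≤ C₃r := Real.rpow_nonneg hC₃ _
  set LX := Real.log X with hLX
  -- `(C₃ s³ ℓ^{e₃})^{2/3} ≤ C₃^{2/3} s² (log X)^{e₃}`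
  have hrpow : (C₃ * (T / N) ^ 3 * Real.log (T / N) ^ e₃) ^ (2 / 3 : ℝ) ≤ C₃r * (T / N) ^ 2 * LX ^ e₃ := by
    rw [rpow_two_thirds_mul hC₃ hs0.le hls0 e₃]
    have := rpow_log_le hls0 hls hlogX e₃
    exact mul_le_mul_of_nonneg_left this (by positivity)
  have hrpow0 : 0 ≤ (C₃ * (T / N) ^ 3 * Real.log (T / N) ^ e₃) ^ (2 / 3 : ℝ) :=
    Real.rpow_nonneg (mul_nonneg (by positivity) (pow_nonneg hls0 _)) _
  -- `R ≤ 2 s² Q₀/Q₁ + 10 s log X + 4T`, `R² ≤ 3(4 s⁴Q₀²/Q₁² + 100 s²(log X)² + 16T²)`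
  set R : ℝ := 2 * (T / N) ^ 2 / (Q₁ / Q₀) + 2 * (T / N) * (1 + Real.log ((⌊3 * T⌋₊ + 1 : ℕ) : ℝ)) +
    ((⌊3 * T⌋₊ + 1 : ℕ) : ℝ) with hR
  have hR0 : 0 ≤ R := by rw [hR]; positivity
  have hRle : R ≤ 2 * (T / N) ^ 2 * Q₀ / Q₁ + 10 * (T / N) * LX + 4 * T := by
    rw [hR]
    have e1 : 2 * (T / N) ^ 2 / (Q₁ / Q₀) = 2 * (T / N) ^ 2 * Q₀ / Q₁ := by field_simp
    rw [e1]
    have : 2 * (T / N) * (1 + Real.log ((⌊3 * T⌋₊ + 1 : ℕ) : ℝ)) ≤ 2 * (T / N) * (5 * LX) :=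
      mul_le_mul_of_nonneg_left hlog3T (by positivity)
    linarith
  have hRsq : R ^ 2 ≤ 3 * (4 * (T / N) ^ 4 * (Q₀ : ℝ) ^ 2 / Q₁ ^ 2 + 100 * (T / N) ^ 2 * LX ^ 2 + 16 * T ^ 2) := by
    have h1 : R ^ 2 ≤ (2 * (T / N) ^ 2 * Q₀ / Q₁ + 10 * (T / N) * LX + 4 * T) ^ 2 := pow_le_pow_left₀ hR0 hRle 2
    refine h1.trans ?_
    have e : 4 * (T / N) ^ 4 * (Q₀ : ℝ) ^ 2 / Q₁ ^ 2 = (2 * (T / N) ^ 2 * Q₀ / Q₁) ^ 2 := by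
      rw [div_pow]; ring
    rw [e]
    nlinarith [sq_nonneg (2 * (T / N) ^ 2 * Q₀ / Q₁ - 10 * (T / N) * LX), sq_nonneg (10 * (T / N) * LX - 4 * T),
      sq_nonneg (2 * (T / N) ^ 2 * Q₀ / Q₁ - 4 * T)]
  -- prefactor: `2 (6N+3)⁶ · 4(1+log Q₀)/Δ₀ · Q₀³ · 2 ≤ 48·9⁶ N⁶ LX (XY/T³) Q₀³`
  have hA : (6 * N + 3) ^ 6 ≤ (9 * N) ^ 6 := pow_le_pow_left₀ (by positivity) (by linarith) 6
  have hpre : 2 * (6 * N + 3) ^ 6 * (4 * (1 + Real.log (Q₀ : ℝ)) / Δ₀ * (Q₀ : ℝ) ^ 3) * 2 ≤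
      48 * 9 ^ 6 * (N ^ 6 * LX * (X * Y / T ^ 3) * (Q₀ : ℝ) ^ 3) := by
    have e : X * Y / T ^ 3 = Δ₀⁻¹ := by rw [hΔ, inv_div]
    rw [e]
    calc 2 * (6 * N + 3) ^ 6 * (4 * (1 + Real.log (Q₀ : ℝ)) / Δ₀ * (Q₀ : ℝ) ^ 3) * 2
        = 16 * ((6 * N + 3) ^ 6 * (1 + Real.log (Q₀ : ℝ)) * (Δ₀⁻¹ * (Q₀ : ℝ) ^ 3)) := by field_simp; ring
      _ ≤ 16 * ((9 * N) ^ 6 * (3 * LX) * (Δ₀⁻¹ * (Q₀ : ℝ) ^ 3)) := by gcongr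
      _ = 48 * 9 ^ 6 * (N ^ 6 * LX * Δ₀⁻¹ * (Q₀ : ℝ) ^ 3) := by ring
  -- the bracket
  have hH : (C₁ * T ^ 3 * Real.exp (-u)) ^ 2 = C₁ ^ 2 * T ^ 6 * Real.exp (-(2 * u)) := by
    rw [show -(2 * u) = -u + -u by ring, Real.exp_add]; ring
  have hbr : (Q₀ : ℝ) ^ 4 * Q₁ ^ 2 * (C₁ * T ^ 3 * Real.exp (-u)) ^ 2 +
      162 * (C₃ * (T / N) ^ 3 * Real.log (T / N) ^ e₃) ^ (2 / 3 : ℝ) * R ^ 2 ≤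
      (Q₀ : ℝ) ^ 4 * Q₁ ^ 2 * (C₁ ^ 2 * T ^ 6 * Real.exp (-(2 * u))) +
      162 * (C₃r * (T / N) ^ 2 * LX ^ e₃) *
        (3 * (4 * (T / N) ^ 4 * (Q₀ : ℝ) ^ 2 / Q₁ ^ 2 + 100 * (T / N) ^ 2 * LX ^ 2 + 16 * T ^ 2)) := by
    rw [hH]
    have : 162 * (C₃ * (T / N) ^ 3 * Real.log (T / N) ^ e₃) ^ (2 / 3 : ℝ) * R ^ 2 ≤
        162 * (C₃r * (T / N) ^ 2 * LX ^ e₃) *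
          (3 * (4 * (T / N) ^ 4 * (Q₀ : ℝ) ^ 2 / Q₁ ^ 2 + 100 * (T / N) ^ 2 * LX ^ 2 + 16 * T ^ 2)) :=
      mul_le_mul (mul_le_mul_of_nonneg_left hrpow (by norm_num)) hRsq (sq_nonneg _) (by positivity)
    linarith
  have hbr0 : 0 ≤ (Q₀ : ℝ) ^ 4 * Q₁ ^ 2 * (C₁ * T ^ 3 * Real.exp (-u)) ^ 2 +
      162 * (C₃ * (T / N) ^ 3 * Real.log (T / N) ^ e₃) ^ (2 / 3 : ℝ) * R ^ 2 := by positivity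
  have hstep : 2 * (6 * N + 3) ^ 6 * (4 * (1 + Real.log (Q₀ : ℝ)) / Δ₀ * (Q₀ : ℝ) ^ 3 *
      (2 * ((Q₀ : ℝ) ^ 4 * Q₁ ^ 2 * (C₁ * T ^ 3 * Real.exp (-u)) ^ 2 +
        162 * (C₃ * (T / N) ^ 3 * Real.log (T / N) ^ e₃) ^ (2 / 3 : ℝ) * R ^ 2))) ≤
      48 * 9 ^ 6 * (N ^ 6 * LX * (X * Y / T ^ 3) * (Q₀ : ℝ) ^ 3) *
        ((Q₀ : ℝ) ^ 4 * Q₁ ^ 2 * (C₁ ^ 2 * T ^ 6 * Real.exp (-(2 * u))) +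
          162 * (C₃r * (T / N) ^ 2 * LX ^ e₃) *
            (3 * (4 * (T / N) ^ 4 * (Q₀ : ℝ) ^ 2 / Q₁ ^ 2 + 100 * (T / N) ^ 2 * LX ^ 2 + 16 * T ^ 2))) := by
    calc _ = (2 * (6 * N + 3) ^ 6 * (4 * (1 + Real.log (Q₀ : ℝ)) / Δ₀ * (Q₀ : ℝ) ^ 3) * 2) *
          ((Q₀ : ℝ) ^ 4 * Q₁ ^ 2 * (C₁ * T ^ 3 * Real.exp (-u)) ^ 2 +
            162 * (C₃ * (T / N) ^ 3 * Real.log (T / N) ^ e₃) ^ (2 / 3 : ℝ) * R ^ 2) := by ring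
      _ ≤ _ := mul_le_mul hpre hbr hbr0 (by positivity)
  refine hstep.trans ?_
  -- expand into four monomials
  have hexp : N ^ 6 * LX * (X * Y / T ^ 3) * (Q₀ : ℝ) ^ 3 *
      ((Q₀ : ℝ) ^ 4 * Q₁ ^ 2 * (C₁ ^ 2 * T ^ 6 * Real.exp (-(2 * u))) +
        162 * (C₃r * (T / N) ^ 2 * LX ^ e₃) *
          (3 * (4 * (T / N) ^ 4 * (Q₀ : ℝ) ^ 2 / Q₁ ^ 2 + 100 * (T / N) ^ 2 * LX ^ 2 + 16 * T ^ 2))) =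
      C₁ ^ 2 * LX * (X * T ^ 3) * (N ^ 6 * Y * (Q₀ : ℝ) ^ 7 * Q₁ ^ 2 * Real.exp (-(2 * u))) +
      1944 * C₃r * (LX ^ e₃ * LX) * (X * Y * T ^ 3 * (Q₀ : ℝ) ^ 5 / Q₁ ^ 2) +
      48600 * C₃r * (LX ^ e₃ * LX ^ 3) * (X * Y * N ^ 2 * T * (Q₀ : ℝ) ^ 3) +
      7776 * C₃r * (LX ^ e₃ * LX) * (X * Y * N ^ 4 * T * (Q₀ : ℝ) ^ 3) := by
    field_simp
    ring
  have hgoal : 48 * 9 ^ 6 * (N ^ 6 * LX * (X * Y / T ^ 3) * (Q₀ : ℝ) ^ 3) *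
      ((Q₀ : ℝ) ^ 4 * Q₁ ^ 2 * (C₁ ^ 2 * T ^ 6 * Real.exp (-(2 * u))) +
        162 * (C₃r * (T / N) ^ 2 * LX ^ e₃) *
          (3 * (4 * (T / N) ^ 4 * (Q₀ : ℝ) ^ 2 / Q₁ ^ 2 + 100 * (T / N) ^ 2 * LX ^ 2 + 16 * T ^ 2))) =
      48 * 9 ^ 6 * (C₁ ^ 2 * LX * (X * T ^ 3) * (N ^ 6 * Y * (Q₀ : ℝ) ^ 7 * Q₁ ^ 2 * Real.exp (-(2 * u))) +
      1944 * C₃r * (LX ^ e₃ * LX) * (X * Y * T ^ 3 * (Q₀ : ℝ) ^ 5 / Q₁ ^ 2) +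
      48600 * C₃r * (LX ^ e₃ * LX ^ 3) * (X * Y * N ^ 2 * T * (Q₀ : ℝ) ^ 3) +
      7776 * C₃r * (LX ^ e₃ * LX) * (X * Y * N ^ 4 * T * (Q₀ : ℝ) ^ 3)) := by
    rw [← hexp]; ring
  rw [hgoal]
  -- the four budgets
  obtain ⟨hvb, hvc⟩ := budget_vbc hX0.le hY hT.le hN0.le hNY hQ₁0.le hYQ
  have hhyp := budget_hyp hY hN0.le hNY hQ₁ hQ₀0.le hQ₀ hQe
  have hva := budget_va hX0.le hY hT.le hQ₁ hQ₀0.le hQ₀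
  have hQ3 : (Q₀ : ℝ) ^ 3 ≤ Q₁ := by
    calc (Q₀ : ℝ) ^ 3 ≤ (Q₁ ^ (1 / 3 : ℝ)) ^ 3 := pow_le_pow_left₀ hQ₀0.le hQ₀ 3
      _ = Q₁ := by rw [← Real.rpow_natCast, ← Real.rpow_mul hQ₁0.le]; norm_num
  have hM3 : X * Y * N ^ 2 * T * (Q₀ : ℝ) ^ 3 ≤ 4992 ^ 2 * (X * T ^ 3 / Y) := by
    calc X * Y * N ^ 2 * T * (Q₀ : ℝ) ^ 3 ≤ X * Y * N ^ 2 * T * Q₁ := by gcongr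
      _ ≤ 4992 ^ 2 * (X * T ^ 3 / Y) := hvb
  have hM4 : X * Y * N ^ 4 * T * (Q₀ : ℝ) ^ 3 ≤ 4992 ^ 4 * (X * T ^ 3 / Y) := by
    calc X * Y * N ^ 4 * T * (Q₀ : ℝ) ^ 3 ≤ X * Y * N ^ 4 * T * Q₁ := by gcongr
      _ ≤ 4992 ^ 4 * (X * T ^ 3 / Y) := hvc
  -- log powers
  have hLX1 : 1 ≤ LX := hlogX
  have hL1 : LX ^ e₃ * LX ≤ LX ^ (e₃ + 3) := by
    rw [show e₃ + 3 = (e₃ + 1) + 2 from rfl, pow_add, pow_succ]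
    exact le_mul_of_one_le_right (by positivity) (one_le_pow₀ hLX1)
  have hL3 : LX ^ e₃ * LX ^ 3 = LX ^ (e₃ + 3) := by rw [pow_add]
  have hL0 : 0 ≤ LX ^ e₃ * LX := by positivity
  -- assemble
  have hB0 : 0 ≤ X * T ^ 3 := by positivity
  have t1 : C₁ ^ 2 * LX * (X * T ^ 3) * (N ^ 6 * Y * (Q₀ : ℝ) ^ 7 * Q₁ ^ 2 * Real.exp (-(2 * u))) ≤
      C₁ ^ 2 * LX * (X * T ^ 3) * (4992 ^ 6 * (Y ^ 16 * Q₁ ^ 4 * Real.exp (-u))) :=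
    mul_le_mul_of_nonneg_left hhyp (by positivity)
  have t2 : 1944 * C₃r * (LX ^ e₃ * LX) * (X * Y * T ^ 3 * (Q₀ : ℝ) ^ 5 / Q₁ ^ 2) ≤
      1944 * C₃r * LX ^ (e₃ + 3) * (X * T ^ 3 * Y ^ 16 * Q₁ ^ (-(1 / 4 : ℝ))) :=
    mul_le_mul (mul_le_mul_of_nonneg_left hL1 (by positivity)) hva (by positivity) (by positivity)
  have t3 : 48600 * C₃r * (LX ^ e₃ * LX ^ 3) * (X * Y * N ^ 2 * T * (Q₀ : ℝ) ^ 3) ≤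
      48600 * C₃r * LX ^ (e₃ + 3) * (4992 ^ 2 * (X * T ^ 3 / Y)) := by
    rw [hL3]; exact mul_le_mul_of_nonneg_left hM3 (by positivity)
  have t4 : 7776 * C₃r * (LX ^ e₃ * LX) * (X * Y * N ^ 4 * T * (Q₀ : ℝ) ^ 3) ≤
      7776 * C₃r * LX ^ (e₃ + 3) * (4992 ^ 4 * (X * T ^ 3 / Y)) :=
    mul_le_mul (mul_le_mul_of_nonneg_left hL1 (by positivity)) hM4 (by positivity) (by positivity)
  have hsum := add_le_add (add_le_add (add_le_add t1 t2) t3) t4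
  refine (mul_le_mul_of_nonneg_left hsum (by norm_num)).trans ?_
  have hextra : 0 ≤ C₃r * LX ^ (e₃ + 3) * (X * T ^ 3 * Y ^ 16 * Q₁ ^ (-(1 / 4 : ℝ))) := by
    have : 0 ≤ Q₁ ^ (-(1 / 4 : ℝ)) := Real.rpow_nonneg hQ₁0.le _
    positivity
  have hfin : C₁ ^ 2 * LX * (X * T ^ 3) * (4992 ^ 6 * (Y ^ 16 * Q₁ ^ 4 * Real.exp (-u))) +
          1944 * C₃r * LX ^ (e₃ + 3) * (X * T ^ 3 * Y ^ 16 * Q₁ ^ (-(1 / 4 : ℝ))) +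
        48600 * C₃r * LX ^ (e₃ + 3) * (4992 ^ 2 * (X * T ^ 3 / Y)) +
      7776 * C₃r * LX ^ (e₃ + 3) * (4992 ^ 4 * (X * T ^ 3 / Y)) ≤
      (X * T ^ 3) *
        (4992 ^ 6 * C₁ ^ 2 * (Y ^ 16 * Q₁ ^ 4 * Real.exp (-u)) * LX +
          486 * C₃r * (12 * (Y ^ 16 * Q₁ ^ (-(1 / 4 : ℝ))) + (100 * 4992 ^ 2 + 16 * 4992 ^ 4) * Y⁻¹) *
            LX ^ (e₃ + 3)) := by
    simp only [div_eq_mul_inv]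
    have hid : (X * T ^ 3) *
        (4992 ^ 6 * C₁ ^ 2 * (Y ^ 16 * Q₁ ^ 4 * Real.exp (-u)) * LX +
          486 * C₃r * (12 * (Y ^ 16 * Q₁ ^ (-(1 / 4 : ℝ))) + (100 * 4992 ^ 2 + 16 * 4992 ^ 4) * Y⁻¹) *
            LX ^ (e₃ + 3)) -
      (C₁ ^ 2 * LX * (X * T ^ 3) * (4992 ^ 6 * (Y ^ 16 * Q₁ ^ 4 * Real.exp (-u))) +
          1944 * C₃r * LX ^ (e₃ + 3) * (X * T ^ 3 * Y ^ 16 * Q₁ ^ (-(1 / 4 : ℝ))) +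
        48600 * C₃r * LX ^ (e₃ + 3) * (4992 ^ 2 * (X * T ^ 3 * Y⁻¹)) +
      7776 * C₃r * LX ^ (e₃ + 3) * (4992 ^ 4 * (X * T ^ 3 * Y⁻¹))) =
      3888 * (C₃r * LX ^ (e₃ + 3) * (X * T ^ 3 * Y ^ 16 * Q₁ ^ (-(1 / 4 : ℝ)))) := by ring
    linarith [hid, hextra]
  calc 48 * 9 ^ 6 * (C₁ ^ 2 * LX * (X * T ^ 3) * (4992 ^ 6 * (Y ^ 16 * Q₁ ^ 4 * Real.exp (-u))) +
          1944 * C₃r * LX ^ (e₃ + 3) * (X * T ^ 3 * Y ^ 16 * Q₁ ^ (-(1 / 4 : ℝ))) +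
        48600 * C₃r * LX ^ (e₃ + 3) * (4992 ^ 2 * (X * T ^ 3 / Y)) +
      7776 * C₃r * LX ^ (e₃ + 3) * (4992 ^ 4 * (X * T ^ 3 / Y)))
      ≤ 48 * 9 ^ 6 * ((X * T ^ 3) *
        (4992 ^ 6 * C₁ ^ 2 * (Y ^ 16 * Q₁ ^ 4 * Real.exp (-u)) * LX +
          486 * C₃r * (12 * (Y ^ 16 * Q₁ ^ (-(1 / 4 : ℝ))) + (100 * 4992 ^ 2 + 16 * 4992 ^ 4) * Y⁻¹) *
            LX ^ (e₃ + 3))) := mul_le_mul_of_nonneg_left hfin (by norm_num)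
    _ = _ := by ring

/-! ### The bound for `S` -/

set_option maxHeartbeats 2000000 in
open scoped Classical in
/-- **The bound for `S = S₁ + S₂`** under explicit parameter inequalities (`T³ = V`, `W = X^{τ/2}`,
`N = 1248(⌊Y⌋₊+1)²`, `Δ₀ = V/(XY)`, `d₀ = VY⁷/X`, `Q₀ = ⌊Q₁^{1/3}⌋₊`), with the constants of the auxiliary
lemmas (`S₁`, the box divisor sum, Lemma 4.5, Lemma 11.1, the tail) supplied as hypotheses.
[cite: HeathBrownActa2001, §13 p. 83] -/
theorem Ssum_le_of_params {X η τ V T Y Q₁ C₁ c₁ c₅ W : ℝ} {nn : ℕ} {m : Fin (nn + 1) → ℕ}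
    -- constants
    {CS CB C₂ C₃ C₁₁ CT κ eS : ℝ} {eB e₂ e₃ E eT : ℕ}
    (hCS : 0 < CS) (hCB : 0 < CB) (hC₂ : 0 < C₂) (hC₃ : 0 < C₃) (hC₁₁ : 0 < C₁₁) (hCT : 0 < CT) (heS : 0 ≤ eS)
    (hS1 : S1sum X η τ m V T ≤ CS * X ^ 2 * Real.log X ^ eS)
    (hbox : ∑ v ∈ Bbox T, (idealDivisorCount (Ideal.span {coordElt v}) : ℝ) ^ 2 ≤
      CB * (3 * T) ^ 3 * Real.log (2 * (3 * T) + 2) ^ eB)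
    (h45₂ : ∀ (a : ℝ × ℝ × ℝ) (S₀ : ℝ), 2 ≤ S₀ → |a.1| ≤ S₀ ^ 3 → |a.2.1| ≤ S₀ ^ 3 → |a.2.2| ≤ S₀ ^ 3 →
      ∑ v ∈ latticeCube a S₀, (idealDivisorCount (Ideal.span {coordElt v}) : ℝ) ^ 2 ≤ C₂ * S₀ ^ 3 * Real.log S₀ ^ e₂)
    (h45₃ : ∀ (a : ℝ × ℝ × ℝ) (S₀ : ℝ), 2 ≤ S₀ → |a.1| ≤ S₀ ^ 3 → |a.2.1| ≤ S₀ ^ 3 → |a.2.2| ≤ S₀ ^ 3 →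
      ∑ v ∈ latticeCube a S₀, (idealDivisorCount (Ideal.span {coordElt v}) : ℝ) ^ 3 ≤ C₃ * S₀ ^ 3 * Real.log S₀ ^ e₃)
    (h11 : ∀ (a₁ a₂ : ℝ × ℝ × ℝ) (S₀ : ℝ), 2 ≤ S₀ →
      |a₁.1| ≤ S₀ ^ 3 → |a₁.2.1| ≤ S₀ ^ 3 → |a₁.2.2| ≤ S₀ ^ 3 →
        ∀ D : ℕ, 1 ≤ D → (D : ℝ) ≤ κ * S₀ →
          ∑ b ∈ (latticeCube a₁ S₀).filter IsPrimitiveVec,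
              ∑ _x ∈ (latticeCube a₂ S₀).filter (fun x => DvdVec (D : ℤ) (cross3 b x)),
                (idealDivisorCount (Ideal.span {coordElt b}) : ℝ) ^ 2 ≤
            C₁₁ * S₀ ^ 6 / (D : ℝ) ^ 2 * Real.log S₀ ^ E)
    (hTL : TL T (T ^ 3 * Y ^ 7 / X) ≤ CT * (T ^ 6 / (T ^ 3 * Y ^ 7 / X) + T ^ 5) * Real.log T ^ eT)
    -- structure
    (hη0 : 0 ≤ η) (hη1 : η ≤ 1) (hτ : 0 < τ) (hτ1 : τ ≤ 1) (hm : CoreAdmissible τ m)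
    (hHyp : Hyp314 X τ m Q₁ C₁ c₁ 3 1) (hc₅ : 0 < c₅)
    -- parameters
    (hX : 2 ≤ X) (hlogX : 1 ≤ Real.log X) (hY : 1 ≤ Y) (hQ₁ : 1 ≤ Q₁) (hQ₁X : Q₁ ≤ X)
    (hT1 : 1 ≤ T) (hTV : T ^ 3 = V) (hTX : T ≤ X) (hT56 : T ^ 2 ≤ 56 * X)
    (hW : W = X ^ (τ / 2)) (hXW : X * W ≤ T ^ 3) (hTW : T ^ 2 * W ≤ X)
    (hYQ : Y ^ 10 * Q₁ ≤ T ^ 2) (hc₅V : c₅ * X * Y ^ 3 ≤ T ^ 3) (hYX : Y ≤ X)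
    (hQe : Q₁ ^ (1 / 3 : ℝ) * Real.exp (-(c₁ * Real.sqrt (Real.log (hbL X τ)))) ≤ 1)
    (hs2 : 2 ≤ T / ((1248 * (⌊Y⌋₊ + 1) ^ 2 : ℕ) : ℝ))
    (hsN : 3 * (((1248 * (⌊Y⌋₊ + 1) ^ 2 : ℕ)) : ℝ) + 2 ≤ (T / ((1248 * (⌊Y⌋₊ + 1) ^ 2 : ℕ) : ℝ)) ^ 2)
    (hsL : hbL X τ ^ 2 ≤ T / ((1248 * (⌊Y⌋₊ + 1) ^ 2 : ℕ) : ℝ)) (hVX : X ≤ 270 * V)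
    (hκs : 270 * V / X ≤ κ * (T / ((1248 * (⌊Y⌋₊ + 1) ^ 2 : ℕ) : ℝ)))
    (hΔ1 : 1 ≤ V / (X * Y)) (hΔT : V / (X * Y) ≤ T) (hd₀ : 1 ≤ T ^ 3 * Y ^ 7 / X) :
    Ssum X η τ m V T ≤
      (CS + 2 * 81 * 27 * 87808 * 4 ^ eB * CB + 162 * CT + 2 * 81 * 34000000000 * 12 * 9 ^ 5 * (2 + 3 / c₅) * C₁₁ +
          2 * 9 ^ 6 * 414720 * 11 * 81 * (16 + (19968 + 4992 ^ 3)) * C₂ +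
          48 * 9 ^ 6 * (4992 ^ 6 * C₁ ^ 2 + 162 * 3 * (12 + (100 * 4992 ^ 2 + 16 * 4992 ^ 4)) * C₃ ^ (2 / 3 : ℝ))) *
        (X * V) * (Y⁻¹ + Y ^ 60 * X ^ (-(τ / 2)) + Y ^ 16 * Q₁ ^ (-(1 / 4 : ℝ)) +
          Y ^ 16 * Q₁ ^ 4 * Real.exp (-(c₁ * Real.sqrt (Real.log (hbL X τ))))) *
        Real.log X ^ (eS + (eB : ℝ) + eT + (E + 1 : ℕ) + (e₂ + 1 : ℕ) + (e₃ + 3 : ℕ)) := by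
  classical
  -- V := T³
  subst hTV
  have hX0 : 0 < X := by linarith
  have hX1 : 1 < X := by linarith
  have hY0 : 0 < Y := by linarith
  have hT : 0 < T := by linarith
  have hQ₁0 : 0 < Q₁ := by linarith
  set LX := Real.log X with hLX
  -- the hypercube parameter
  set Nn : ℕ := 1248 * (⌊Y⌋₊ + 1) ^ 2 with hNn
  obtain ⟨hN1248, hNY2, hN4992⟩ := N_param_facts hY
  rw [← hNn] at hN1248 hNY2 hN4992
  set N : ℝ := (Nn : ℝ) with hN
  have hN1 : (1 : ℝ) ≤ N := by rw [hN]; exact_mod_cast le_trans (by norm_num) hN1248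
  have hN0 : 0 < N := by linarith
  have hNpos : 0 < Nn := by omega
  have hs1 : 1 ≤ T / N := by linarith
  have hsT : T / N ≤ T := div_le_self hT.le hN1
  have hls0 : 0 ≤ Real.log (T / N) := Real.log_nonneg hs1
  have hls : Real.log (T / N) ≤ LX := (Real.log_le_log (by linarith) hsT).trans (Real.log_le_log hT hTX)
  have hlogT : Real.log T ≤ LX := Real.log_le_log hT hTX
  have hlogT0 : 0 ≤ Real.log T := Real.log_nonneg hT1
  -- `Q₀`
  set Q₀ : ℕ := ⌊Q₁ ^ (1 / 3 : ℝ)⌋₊ with hQ₀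
  have hQ13 : 1 ≤ Q₁ ^ (1 / 3 : ℝ) := Real.one_le_rpow hQ₁ (by norm_num)
  have hQ₀1 : 1 ≤ Q₀ := Nat.le_floor (by simpa using hQ13)
  have hQ₀1R : (1 : ℝ) ≤ Q₀ := by exact_mod_cast hQ₀1
  have hQ₀le : (Q₀ : ℝ) ≤ Q₁ ^ (1 / 3 : ℝ) := Nat.floor_le (by linarith)
  have hQ₀ge : Q₁ ^ (1 / 3 : ℝ) / 2 ≤ (Q₀ : ℝ) := half_le_floor hQ13
  have hQ₀Q₁ : (Q₀ : ℝ) ≤ Q₁ := hQ₀le.trans (by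
    calc Q₁ ^ (1 / 3 : ℝ) ≤ Q₁ ^ (1 : ℝ) := Real.rpow_le_rpow_of_exponent_le hQ₁ (by norm_num)
      _ = Q₁ := Real.rpow_one Q₁)
  have hQ₀X : (Q₀ : ℝ) ≤ X := hQ₀Q₁.trans hQ₁X
  -- `Δ₀`, `d₀`, `W`
  set Δ₀ : ℝ := T ^ 3 / (X * Y) with hΔ₀
  set d₀ : ℝ := T ^ 3 * Y ^ 7 / X with hd₀def
  have hW1 : 1 ≤ W := by rw [hW]; exact Real.one_le_rpow (by linarith) (by linarith)
  have hW0 : 0 < W := by linarith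
  have hWinv : X ^ (-(τ / 2)) = W⁻¹ := by rw [hW, Real.rpow_neg hX0.le]
  have hΔD : Δ₀ ≤ 270 * T ^ 3 / X := by
    calc Δ₀ = T ^ 3 / (X * Y) := hΔ₀
      _ ≤ T ^ 3 / X := div_le_div_of_nonneg_left (by positivity) hX0 (le_mul_of_one_le_right hX0.le hY)
      _ ≤ 270 * T ^ 3 / X := div_le_div_of_nonneg_right (by linarith [pow_pos hT 3]) hX0.le
  have hdX : d₀ ≤ X ^ 9 := by
    rw [hd₀def, div_le_iff₀ hX0]
    have h1 : T ^ 3 ≤ X ^ 3 := pow_le_pow_left₀ hT.le hTX 3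
    have h2 : Y ^ 7 ≤ X ^ 7 := pow_le_pow_left₀ hY0.le hYX 7
    calc T ^ 3 * Y ^ 7 ≤ X ^ 3 * X ^ 7 := mul_le_mul h1 h2 (by positivity) (by positivity)
      _ = X ^ 9 * X := by ring
  obtain ⟨-, hlogd, hlogQ₀, hlog3T, hlog6T⟩ :=
    log_bookkeeping (Q₀ := (Q₀ : ℝ)) hX hlogX hY hYX hT1 hTX hQ₀1R hQ₀X hd₀ hdX
  -- Step 1: `S = S₁ + S₃ + 2 S₄⁺`
  have hdecomp : Ssum X η τ m (T ^ 3) T =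
      S1sum X η τ m (T ^ 3) T + S3sum X η τ m (T ^ 3) T Δ₀ + 2 * S4plus X η τ m (T ^ 3) T Δ₀ := by
    rw [Ssum_eq_S1_add_S2, S2sum_eq_S3_add_S4 Δ₀, S4sum_eq_two_mul_S4plus hX0 hη1 hT rfl Δ₀]; ring
  -- Step 2: `S₁`
  have hB0 : 0 ≤ X * T ^ 3 := by positivity
  have hS1' : S1sum X η τ m (T ^ 3) T ≤ CS * (X * T ^ 3) * (Y ^ 60 * W⁻¹) * LX ^ eS := by
    have h1 := budget_S1 hX0.le hY hW0 hXW
    have hL : 0 ≤ LX ^ eS := Real.rpow_nonneg (by linarith) _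
    calc S1sum X η τ m (T ^ 3) T ≤ CS * X ^ 2 * LX ^ eS := hS1
      _ ≤ CS * (X * T ^ 3 / W * Y ^ 60) * LX ^ eS := by gcongr
      _ = CS * (X * T ^ 3) * (Y ^ 60 * W⁻¹) * LX ^ eS := by field_simp
  -- Step 3: `S₃`
  have hS3' : |S3sum X η τ m (T ^ 3) T Δ₀| ≤ 2 * 81 * 27 * 87808 * 4 ^ eB * CB * (X * T ^ 3) * Y⁻¹ * LX ^ eB := by
    have h := abs_S3sum_le (τ := τ) (m := m) (V := T ^ 3) hX0.le hη1 hT (Δ₀ := Δ₀) (by positivity)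
    have hFb : ∑ b ∈ Bbox T, Fb X τ m (T ^ 3) T b ^ 2 ≤ 81 * (CB * (3 * T) ^ 3 * (4 * LX) ^ eB) := by
      calc ∑ b ∈ Bbox T, Fb X τ m (T ^ 3) T b ^ 2
          ≤ ∑ b ∈ Bbox T, 81 * (idealDivisorCount (Ideal.span {coordElt b}) : ℝ) ^ 2 :=
            sum_le_sum fun b _ => Fb_sq_le hX1 hτ hτ1 hm b
        _ = 81 * ∑ b ∈ Bbox T, (idealDivisorCount (Ideal.span {coordElt b}) : ℝ) ^ 2 := by rw [mul_sum]
        _ ≤ 81 * (CB * (3 * T) ^ 3 * Real.log (2 * (3 * T) + 2) ^ eB) := by gcongr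
        _ ≤ 81 * (CB * (3 * T) ^ 3 * (4 * LX) ^ eB) := by
            gcongr
            exact Real.log_nonneg (by linarith)
    have hbud := budget_S3 hX0 hY hT rfl hΔT hT56
    have hF0 : 0 ≤ ∑ b ∈ Bbox T, Fb X τ m (T ^ 3) T b ^ 2 := sum_nonneg fun b _ => sq_nonneg _
    have hΔ00 : 0 ≤ Δ₀ * (6 * T + Δ₀) * (56 * X / T ^ 2 + 1) ^ 2 := by positivity
    calc |S3sum X η τ m (T ^ 3) T Δ₀| ≤ 2 * (∑ b ∈ Bbox T, Fb X τ m (T ^ 3) T b ^ 2) * (Δ₀ * (6 * T + Δ₀) * (56 * X / T ^ 2 + 1) ^ 2) := h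
      _ ≤ 2 * (81 * (CB * (3 * T) ^ 3 * (4 * LX) ^ eB)) * (87808 * X / Y) := by gcongr
      _ = 2 * 81 * 27 * 87808 * 4 ^ eB * CB * (X * T ^ 3) * Y⁻¹ * LX ^ eB := by
          rw [mul_pow, mul_pow]; field_simp; norm_num
  -- Step 4: `S₄⁺`
  have hS4 := abs_S4plus_le (X := X) (η := η) (τ := τ) (V := T ^ 3) (T := T) (N := Nn) hX1 hη0 hη1 hτ hτ1 hm hHyp hT rfl
    hN1248 hs2 hsN hsL hVX hC₂ hC₃ hC₁₁ h45₂ h45₃ h11 hκs hQ₀1 hQ₀Q₁ hΔ1 hΔD hd₀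
  -- the pieces
  have hp_II := piece_classII (E := E) hX hlogX hY hYX hT hN1 hNY2 hΔ₀ hc₅ hc₅V hC₁₁.le hls0 hls
  have hp_L := piece_large (e₂ := e₂) (Q₀ := Q₀) hX hlogX hY hT hN1 hN4992 hs1 hΔ₀ hd₀def hd₀ hlogd hQ₁ hQ₀ge hW1 hTW hC₂.le hls0 hls
  have hp_S := piece_small (C₁ := C₁) (e₃ := e₃) (u := c₁ * Real.sqrt (Real.log (hbL X τ))) hX hlogX hY hT1 hN1 hN4992 hs1 hΔ₀ hQ₁
    hQ₀1R hQ₀le hlogQ₀ hlog3T hYQ hQe hC₃.le hls0 hls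
  have hp_T : 162 * TL T d₀ ≤ 162 * CT * (X * T ^ 3) * (Y⁻¹ + Y ^ 60 * W⁻¹) * LX ^ eT := by
    have hbud := budget_TL hX0 hY hT hW0 hTW
    have h1 : TL T d₀ ≤ CT * (X * T ^ 3 / Y + X * T ^ 3 / W * Y ^ 60) * LX ^ eT := by
      calc TL T d₀ ≤ CT * (T ^ 6 / (T ^ 3 * Y ^ 7 / X) + T ^ 5) * Real.log T ^ eT := hTL
        _ ≤ CT * (X * T ^ 3 / Y + X * T ^ 3 / W * Y ^ 60) * LX ^ eT := by
            gcongr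
    calc 162 * TL T d₀ ≤ 162 * (CT * (X * T ^ 3 / Y + X * T ^ 3 / W * Y ^ 60) * LX ^ eT) := by linarith
      _ = 162 * CT * (X * T ^ 3) * (Y⁻¹ + Y ^ 60 * W⁻¹) * LX ^ eT := by field_simp
  -- `2|S₄⁺| ≤ small + large + tail + classII`
  have h2S4 : 2 * |S4plus X η τ m (T ^ 3) T Δ₀| ≤
      48 * 9 ^ 6 * (X * T ^ 3) *
        (4992 ^ 6 * C₁ ^ 2 * (Y ^ 16 * Q₁ ^ 4 * Real.exp (-(c₁ * Real.sqrt (Real.log (hbL X τ))))) * LX +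
          486 * C₃ ^ (2 / 3 : ℝ) * (12 * (Y ^ 16 * Q₁ ^ (-(1 / 4 : ℝ))) + (100 * 4992 ^ 2 + 16 * 4992 ^ 4) * Y⁻¹) * LX ^ (e₃ + 3)) +
      2 * 9 ^ 6 * 414720 * 11 * 81 * C₂ * (X * T ^ 3) *
        (16 * (Y ^ 16 * Q₁ ^ (-(1 / 4 : ℝ))) + (19968 + 4992 ^ 3) * (Y ^ 60 / W)) * LX ^ (e₂ + 1) +
      162 * CT * (X * T ^ 3) * (Y⁻¹ + Y ^ 60 * W⁻¹) * LX ^ eT +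
      2 * 81 * 34000000000 * 12 * 9 ^ 5 * (2 + 3 / c₅) * C₁₁ * (X * T ^ 3 * Y⁻¹) * LX ^ (E + 1) := by
    have h2 := mul_le_mul_of_nonneg_left hS4 (by norm_num : (0:ℝ) ≤ 2)
    rw [← hN] at h2
    linarith [h2, hp_S, hp_L, hp_T, hp_II]
  -- Step 5: domination by the four target terms (big numerals abstracted first)
  set u1 : ℝ := Y⁻¹ with hu1
  set u2 : ℝ := Y ^ 60 * W⁻¹ with hu2
  set u3 : ℝ := Y ^ 16 * Q₁ ^ (-(1 / 4 : ℝ)) with hu3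
  set u4 : ℝ := Y ^ 16 * Q₁ ^ 4 * Real.exp (-(c₁ * Real.sqrt (Real.log (hbL X τ)))) with hu4
  rw [hWinv]
  have hYW : Y ^ 60 / W = u2 := by rw [hu2, div_eq_mul_inv]
  rw [hYW] at h2S4
  have hK₁0 : (0 : ℝ) ≤ 100 * 4992 ^ 2 + 16 * 4992 ^ 4 := by norm_num
  have hK₂0 : (0 : ℝ) ≤ 19968 + 4992 ^ 3 := by norm_num
  have hK₃0 : (0 : ℝ) ≤ 2 * 81 * 27 * 87808 := by norm_num
  have hK₄0 : (0 : ℝ) ≤ 2 * 81 * 34000000000 * 12 * 9 ^ 5 := by norm_num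
  have hK₅0 : (0 : ℝ) ≤ 2 * 9 ^ 6 * 414720 * 11 * 81 := by norm_num
  have hK₆0 : (0 : ℝ) ≤ 48 * 9 ^ 6 := by norm_num
  have hK₇0 : (0 : ℝ) ≤ 4992 ^ 6 := by norm_num
  generalize (100 * 4992 ^ 2 + 16 * 4992 ^ 4 : ℝ) = K₁ at h2S4 hK₁0 ⊢
  generalize (19968 + 4992 ^ 3 : ℝ) = K₂ at h2S4 hK₂0 ⊢
  generalize (2 * 81 * 27 * 87808 : ℝ) = K₃ at hS3' hK₃0 ⊢
  generalize (2 * 81 * 34000000000 * 12 * 9 ^ 5 : ℝ) = K₄ at h2S4 hK₄0 ⊢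
  generalize (2 * 9 ^ 6 * 414720 * 11 * 81 : ℝ) = K₅ at h2S4 hK₅0 ⊢
  generalize (48 * 9 ^ 6 : ℝ) = K₆ at h2S4 hK₆0 ⊢
  generalize (4992 ^ 6 : ℝ) = K₇ at h2S4 hK₇0 ⊢
  set U : ℝ := u1 + u2 + u3 + u4 with hU
  have hu10 : 0 ≤ u1 := by positivity
  have hu20 : 0 ≤ u2 := by positivity
  have hu30 : 0 ≤ u3 := by have : 0 ≤ Q₁ ^ (-(1 / 4 : ℝ)) := Real.rpow_nonneg hQ₁0.le _; positivity
  have hu40 : 0 ≤ u4 := by positivity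
  have hU0 : 0 ≤ U := by linarith
  have hU1 : u1 ≤ U := by linarith
  have hU2 : u2 ≤ U := by linarith
  have hU3 : u3 ≤ U := by linarith
  have hU4 : u4 ≤ U := by linarith
  set etot : ℝ := eS + (eB : ℝ) + eT + (E + 1 : ℕ) + (e₂ + 1 : ℕ) + (e₃ + 3 : ℕ) with hetot
  set Lmax : ℝ := LX ^ etot with hLmax
  have hLX0 : 0 ≤ LX := by linarith
  have heB0 : (0 : ℝ) ≤ eB := Nat.cast_nonneg _
  have heT0 : (0 : ℝ) ≤ eT := Nat.cast_nonneg _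
  have hE0 : (0 : ℝ) ≤ ((E + 1 : ℕ) : ℝ) := Nat.cast_nonneg _
  have he20 : (0 : ℝ) ≤ ((e₂ + 1 : ℕ) : ℝ) := Nat.cast_nonneg _
  have he33 : (3 : ℝ) ≤ ((e₃ + 3 : ℕ) : ℝ) := by push_cast; linarith [(Nat.cast_nonneg e₃ : (0:ℝ) ≤ e₃)]
  have hLnat : ∀ n : ℕ, (n : ℝ) ≤ etot → LX ^ n ≤ Lmax := fun n hn => by
    rw [← Real.rpow_natCast]; exact Real.rpow_le_rpow_of_exponent_le hlogX hn
  have hLS : LX ^ eS ≤ Lmax := Real.rpow_le_rpow_of_exponent_le hlogX (by linarith)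
  have hLB : LX ^ eB ≤ Lmax := hLnat eB (by linarith)
  have hLT : LX ^ eT ≤ Lmax := hLnat eT (by linarith)
  have hLE : LX ^ (E + 1) ≤ Lmax := hLnat (E + 1) (by linarith)
  have hL2 : LX ^ (e₂ + 1) ≤ Lmax := hLnat (e₂ + 1) (by linarith)
  have hL3 : LX ^ (e₃ + 3) ≤ Lmax := hLnat (e₃ + 3) (by linarith)
  have hL1 : LX ≤ Lmax := by
    have := hLnat 1 (by push_cast; linarith)
    simpa using this
  have hLmax0 : 0 ≤ Lmax := Real.rpow_nonneg hLX0 _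
  set M : ℝ := X * T ^ 3 * U * Lmax with hM
  set B : ℝ := X * T ^ 3 with hB
  -- (a) `S₁`
  have qa : CS * B * u2 * LX ^ eS ≤ CS * M := by
    rw [hM]; exact piece_le hCS.le hB0 hu20 hU2 (Real.rpow_nonneg hLX0 eS) hLS
  -- (b) `S₃`
  have qb : K₃ * 4 ^ eB * CB * B * u1 * LX ^ eB ≤ K₃ * 4 ^ eB * CB * M := by
    rw [hM]; exact piece_le (by positivity) hB0 hu10 hU1 (pow_nonneg hLX0 eB) hLB
  -- (c) small moduli
  have qc : K₆ * B * (K₇ * C₁ ^ 2 * u4 * LX + 486 * C₃ ^ (2 / 3 : ℝ) * (12 * u3 + K₁ * u1) * LX ^ (e₃ + 3)) ≤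
      K₆ * (K₇ * C₁ ^ 2 + 162 * 3 * (12 + K₁) * C₃ ^ (2 / 3 : ℝ)) * M := by
    have hC₃r : 0 ≤ C₃ ^ (2 / 3 : ℝ) := Real.rpow_nonneg hC₃.le _
    have c1 : K₇ * C₁ ^ 2 * u4 * LX ≤ K₇ * C₁ ^ 2 * (U * Lmax) := by
      have h1 : u4 * LX ≤ U * Lmax := mul_le_mul hU4 hL1 hLX0 hU0
      have h0 : 0 ≤ K₇ * C₁ ^ 2 := by positivity
      calc K₇ * C₁ ^ 2 * u4 * LX = K₇ * C₁ ^ 2 * (u4 * LX) := by ring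
        _ ≤ K₇ * C₁ ^ 2 * (U * Lmax) := mul_le_mul_of_nonneg_left h1 h0
    have c2 : 486 * C₃ ^ (2 / 3 : ℝ) * (12 * u3 + K₁ * u1) * LX ^ (e₃ + 3) ≤
        486 * C₃ ^ (2 / 3 : ℝ) * ((12 + K₁) * U) * Lmax := by
      have hK : K₁ * u1 ≤ K₁ * U := mul_le_mul_of_nonneg_left hU1 hK₁0
      have hcomb : 12 * u3 + K₁ * u1 ≤ (12 + K₁) * U := by linarith
      have hcomb0 : 0 ≤ 12 * u3 + K₁ * u1 := by positivity
      exact mul_le_mul (mul_le_mul_of_nonneg_left hcomb (by positivity)) hL3 (pow_nonneg hLX0 _) (by positivity)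
    have hsum := add_le_add c1 c2
    calc K₆ * B * (K₇ * C₁ ^ 2 * u4 * LX + 486 * C₃ ^ (2 / 3 : ℝ) * (12 * u3 + K₁ * u1) * LX ^ (e₃ + 3))
        ≤ K₆ * B * (K₇ * C₁ ^ 2 * (U * Lmax) + 486 * C₃ ^ (2 / 3 : ℝ) * ((12 + K₁) * U) * Lmax) :=
          mul_le_mul_of_nonneg_left hsum (by positivity)
      _ = _ := by rw [hM]; ring
  -- (d) large sieve
  have qd : K₅ * C₂ * B * (16 * u3 + K₂ * u2) * LX ^ (e₂ + 1) ≤ K₅ * (16 + K₂) * C₂ * M := by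
    have hK : K₂ * u2 ≤ K₂ * U := mul_le_mul_of_nonneg_left hU2 hK₂0
    have hcomb : 16 * u3 + K₂ * u2 ≤ (16 + K₂) * U := by linarith
    have hcomb0 : 0 ≤ 16 * u3 + K₂ * u2 := by positivity
    have h1 : (16 * u3 + K₂ * u2) * LX ^ (e₂ + 1) ≤ ((16 + K₂) * U) * Lmax :=
      mul_le_mul hcomb hL2 (pow_nonneg hLX0 _) (by positivity)
    calc K₅ * C₂ * B * (16 * u3 + K₂ * u2) * LX ^ (e₂ + 1)
        = K₅ * C₂ * B * ((16 * u3 + K₂ * u2) * LX ^ (e₂ + 1)) := by ring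
      _ ≤ K₅ * C₂ * B * (((16 + K₂) * U) * Lmax) := mul_le_mul_of_nonneg_left h1 (by positivity)
      _ = _ := by rw [hM]; ring
  -- (e) tail
  have qe : 162 * CT * B * (u1 + u2) * LX ^ eT ≤ 162 * CT * M := by
    rw [hM]
    exact piece_le (by positivity) hB0 (by positivity : 0 ≤ u1 + u2) (by linarith : u1 + u2 ≤ U) (pow_nonneg hLX0 eT) hLT
  -- (f) Class II
  have qf : K₄ * (2 + 3 / c₅) * C₁₁ * (B * u1) * LX ^ (E + 1) ≤ K₄ * (2 + 3 / c₅) * C₁₁ * M := by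
    rw [hM]
    have := piece_le (c := K₄ * (2 + 3 / c₅) * C₁₁) (by positivity) hB0 hu10 hU1 (pow_nonneg hLX0 (E + 1)) hLE
    calc K₄ * (2 + 3 / c₅) * C₁₁ * (B * u1) * LX ^ (E + 1) = K₄ * (2 + 3 / c₅) * C₁₁ * B * u1 * LX ^ (E + 1) := by ring
      _ ≤ _ := this
  -- conclusion
  have hS3le : S3sum X η τ m (T ^ 3) T Δ₀ ≤ |S3sum X η τ m (T ^ 3) T Δ₀| := le_abs_self _
  have hS4le : S4plus X η τ m (T ^ 3) T Δ₀ ≤ |S4plus X η τ m (T ^ 3) T Δ₀| := le_abs_self _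
  have hfinal : Ssum X η τ m (T ^ 3) T ≤
      (CS + K₃ * 4 ^ eB * CB + 162 * CT + K₄ * (2 + 3 / c₅) * C₁₁ + K₅ * (16 + K₂) * C₂ +
          K₆ * (K₇ * C₁ ^ 2 + 162 * 3 * (12 + K₁) * C₃ ^ (2 / 3 : ℝ))) * M := by
    rw [hdecomp]
    linarith [hS1', hS3', h2S4, qa, qb, qc, qd, qe, qf, hS3le, hS4le]
  calc Ssum X η τ m (T ^ 3) T ≤ _ := hfinal
    _ = _ := by rw [hM]; ring

end Literature.NumberTheory.Sieve.CubicSieve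

end
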